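import Summits.HodgeConjecture.HodgeConjecture.Theorems.NikulinTwinTransportRealMultiplicationGForm
import Mathlib.LinearAlgebra.TensorProduct.Pi
import Mathlib.LinearAlgebra.BilinearForm.TensorProduct
import Literature.AlgebraicGeometry.Motives.HodgeStructure

/-!
# Route MarkmanPartnerTransport · lattice bridge, I: complexification in the marking picture, for an
# ARBITRARY finite index type

Generic-index version (index type `ι`, any rational / complex bilinear forms `B`, `B_ℂ` compatible on
rational vectors) of the K3-lattice bookkeeping of `Theorems/AnchorTransportAnchorExistenceK3SquareCMFloorComplexification`
(there `ι = K3Index` is hard-wired; the casting lemmas `ratCastVec_*` are the tree's, file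
`NikulinTwinTransportRealMultiplicationGForm`): rational vectors `ι(v) = (v_i)_i ∈ ℂ^ι` of `Λ_ℚ = ℚ^ι`; the
complexification `cxEnd τ` of a rational endomorphism `τ` (`cxEnd τ ∘ ι = ι ∘ τ`; a ring homomorphism,
real; an isometry of `B_ℂ` when `τ` is one of `B`); and, for a rational subspace `T ≤ ℚ^ι` with a
complement `N`, the realisation `ι_T : ℂ ⊗_ℚ T ↪ ℂ^ι` of the abstract complexification of `T` (the
carrier of the tree's filtration-form Hodge structures, `Motives/HodgeStructure`) with its retraction
`λ_T` (`λ_T ∘ ι_T = id`, `ι_T ∘ λ_T = (pr_T)_ℂ`), compatible with complex conjugation and with the base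
change of the restricted form. Written once for all lattices so that the marking pictures of K3 surfaces
(`ℚ²²`), of `K3^{[2]}`-type fourfolds (`ℚ²³`, BBF form) and of any lattice-polarised family share it;
consumer: the `X`-side one-cycle theorem of crux #5 `LowPicardRealMultiplication` (sequels
`…LatticeBridgeHodge`, `…LatticeBridgeSpan`, `…K3Sq2OneCycle`). Pure linear algebra; no named fact, no
sorry. Prover seat hodge-nonav-19652-p1 (gen 8), `--supports stmt-HodgeConjecture-19653`.

References: C. Voisin, *Hodge Theory and Complex Algebraic Geometry I*, §7.1.1; D. Huybrechts,
*Lectures on K3 Surfaces*, Ch. 3 §2.2, Lemma 3.3.1.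
-/

noncomputable section

set_option linter.dupNamespace false

open scoped TensorProduct
open Literature.AlgebraicGeometry.Motives
open Summit.HodgeConjecture.HodgeConjecture.Theorems.NikulinTwinTransport

namespace Summit.HodgeConjecture.HodgeConjecture.Theorems.MarkmanPartnerTransport.LatticeBridge

variable {ι : Type*}

/-! ### Rational vectors of `ℂ^ι` -/

/-- Rational vectors of `ℂ^ι` are real. [folklore] -/
theorem star_ratVec (u : ι → ℚ) : star (fun i => (u i : ℂ)) = fun i => (u i : ℂ) := by
  funext i
  simp only [Pi.star_apply, star_ratCast]

/-- A vector pairing to zero with every rational vector of `N` pairs to zero with the complex span of `N`.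
[folklore] -/
theorem form_eq_zero_of_mem_span {BC : LinearMap.BilinForm ℂ (ι → ℂ)} (N : Submodule ℚ (ι → ℚ)) {x : ι → ℂ}
    (hx : ∀ n ∈ N, BC (fun i => ((n : ι → ℚ) i : ℂ)) x = 0) {w : ι → ℂ}
    (hw : w ∈ Submodule.span ℂ (Set.range fun n : N => fun i => ((n : ι → ℚ) i : ℂ))) : BC w x = 0 := by
  induction hw using Submodule.span_induction with
  | mem w hw =>
    obtain ⟨n, rfl⟩ := hw
    exact hx n n.2
  | zero => rw [map_zero, LinearMap.zero_apply]
  | add a b _ _ ha hb => rw [map_add, LinearMap.add_apply, ha, hb, add_zero]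
  | smul c a _ ha => rw [map_smul, LinearMap.smul_apply, ha, smul_zero]

/-- A rational scalar acts on `ℂ ⊗_ℚ T` through `ℚ ⊂ ℂ`. [folklore] -/
theorem ratCast_smul_eq (T : Submodule ℚ (ι → ℚ)) (q : ℚ) (z : ℂ ⊗[ℚ] T) : (q : ℂ) • z = q • z := by
  rw [show ((q : ℚ) : ℂ) = algebraMap ℚ ℂ q from (eq_ratCast _ q).symm, algebraMap_smul]

variable [Fintype ι]

/-- A rational vector of `ℂ^ι` expanded in the standard basis: `ι v = Σⱼ vⱼ eⱼ`. [folklore] -/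
theorem ratVec_eq_sum (v : ι → ℚ) :
    (fun i => (v i : ℂ)) = ∑ j, (v j : ℂ) • (Pi.basisFun ℂ ι) j := by
  conv_lhs => rw [← (Pi.basisFun ℂ ι).sum_repr (fun i => (v i : ℂ))]
  simp only [Pi.basisFun_repr]

variable [DecidableEq ι]

/-- A vector of `ℚ^ι` expanded in the standard basis: `v = Σⱼ vⱼ eⱼ`. [folklore] -/
theorem eq_sum_single (v : ι → ℚ) : v = ∑ j, v j • (Pi.single j (1 : ℚ) : ι → ℚ) := by
  conv_lhs => rw [← (Pi.basisFun ℚ ι).sum_repr v]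
  simp only [Pi.basisFun_repr, Pi.basisFun_apply]

/-- Two `ℂ`-linear maps on `ℂ^ι` that agree on `ℚ^ι` are equal (the rational standard basis spans).
[folklore] -/
theorem eq_of_forall_ratVec {M : Type*} [AddCommGroup M] [Module ℂ M] {Φ Ψ : (ι → ℂ) →ₗ[ℂ] M}
    (h : ∀ u : ι → ℚ, Φ (fun i => (u i : ℂ)) = Ψ (fun i => (u i : ℂ))) : Φ = Ψ := by
  refine (Pi.basisFun ℂ ι).ext fun j => ?_
  rw [basisFun_eq_ratCastVec]
  exact h _

/-- A complex bilinear form on `ℂ^ι` is determined by its values on rational vectors. [folklore] -/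
theorem bilin_eq_of_forall_ratVec {F G : LinearMap.BilinForm ℂ (ι → ℂ)}
    (h : ∀ u v : ι → ℚ, F (fun i => (u i : ℂ)) (fun i => (v i : ℂ)) = G (fun i => (u i : ℂ)) (fun i => (v i : ℂ))) :
    F = G :=
  eq_of_forall_ratVec fun u => eq_of_forall_ratVec fun v => h u v

/-! ### Complexification of rational endomorphisms of `ℚ^ι` -/

/-- **Complexification `τ_ℂ` of a `ℚ`-linear endomorphism `τ` of `ℚ^ι`**: the `ℂ`-linear endomorphism
of `ℂ^ι` taking the standard basis vector `eⱼ` to `ι (τ eⱼ)` (generic-index version of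
`AnchorExistenceCMFloor.cxEnd`). [cite: VoisinHodgeI2002, §7.1.1] -/
def cxEnd (τ : Module.End ℚ (ι → ℚ)) : Module.End ℂ (ι → ℂ) :=
  (Pi.basisFun ℂ ι).constr ℂ fun j => fun i => ((τ (Pi.single j 1)) i : ℂ)

/-- The complexification extends `τ`: `τ_ℂ (ι v) = ι (τ v)` for `v ∈ ℚ^ι`. [folklore] -/
theorem cxEnd_ratVec (τ : Module.End ℚ (ι → ℚ)) (v : ι → ℚ) :
    cxEnd τ (fun i => (v i : ℂ)) = fun i => (τ v i : ℂ) := by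
  rw [ratVec_eq_sum, map_sum]
  simp only [map_smul, cxEnd, Module.Basis.constr_basis]
  conv_rhs => rw [eq_sum_single v, map_sum, ratCastVec_sum]
  refine Finset.sum_congr rfl fun j _ => ?_
  rw [map_smul, ratCastVec_smul]

/-- The complexification is characterised by `τ_ℂ ∘ ι = ι ∘ τ`. [folklore] -/
theorem eq_cxEnd_of_forall {τ : Module.End ℚ (ι → ℚ)} {M : Module.End ℂ (ι → ℂ)}
    (hM : ∀ v : ι → ℚ, M (fun i => (v i : ℂ)) = fun i => (τ v i : ℂ)) : M = cxEnd τ :=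
  eq_of_forall_ratVec fun v => by rw [hM, cxEnd_ratVec]

/-- Complexification is a ring homomorphism `End_ℚ(ℚ^ι) → End_ℂ(ℂ^ι)`. [folklore] -/
def cxEndHom : Module.End ℚ (ι → ℚ) →+* Module.End ℂ (ι → ℂ) where
  toFun := cxEnd
  map_one' := (eq_cxEnd_of_forall (M := 1) fun v => rfl).symm
  map_mul' τ₁ τ₂ := (eq_cxEnd_of_forall fun v => by
    rw [Module.End.mul_apply, cxEnd_ratVec, cxEnd_ratVec, Module.End.mul_apply]).symm
  map_zero' := (eq_cxEnd_of_forall (M := 0) fun v => by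
    rw [LinearMap.zero_apply, LinearMap.zero_apply, ratCastVec_zero]).symm
  map_add' τ₁ τ₂ := (eq_cxEnd_of_forall fun v => by
    rw [LinearMap.add_apply, cxEnd_ratVec, cxEnd_ratVec, LinearMap.add_apply, ratCastVec_add]).symm

/-- `cxEndHom` is `cxEnd`. [folklore] -/
@[simp] theorem cxEndHom_apply (τ : Module.End ℚ (ι → ℚ)) : cxEndHom τ = cxEnd τ := rfl

/-- Complexification is compatible with rational scalars. [folklore] -/
theorem cxEnd_smul (q : ℚ) (τ : Module.End ℚ (ι → ℚ)) : cxEnd (q • τ) = (q : ℂ) • cxEnd τ :=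
  (eq_cxEnd_of_forall fun v => by
    rw [LinearMap.smul_apply, cxEnd_ratVec, LinearMap.smul_apply, ratCastVec_smul]).symm

/-- Complexification of the identity. [folklore] -/
theorem cxEnd_one : cxEnd (1 : Module.End ℚ (ι → ℚ)) = 1 := map_one cxEndHom

/-- Complexification of the identity, `LinearMap.id` form. [folklore] -/
theorem cxEnd_id : cxEnd (LinearMap.id : Module.End ℚ (ι → ℚ)) = LinearMap.id := map_one cxEndHom

/-- Complexification of a composite. [folklore] -/
theorem cxEnd_comp (τ₁ τ₂ : Module.End ℚ (ι → ℚ)) : cxEnd (τ₁ ∘ₗ τ₂) = cxEnd τ₁ ∘ₗ cxEnd τ₂ :=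
  map_mul cxEndHom τ₁ τ₂

/-- Complexification of a power. [folklore] -/
theorem cxEnd_pow (τ : Module.End ℚ (ι → ℚ)) (n : ℕ) : cxEnd (τ ^ n) = cxEnd τ ^ n := map_pow cxEndHom τ n

/-- Complexification of a sum. [folklore] -/
theorem cxEnd_add (τ₁ τ₂ : Module.End ℚ (ι → ℚ)) : cxEnd (τ₁ + τ₂) = cxEnd τ₁ + cxEnd τ₂ :=
  map_add cxEndHom τ₁ τ₂

/-- Complexification of a difference. [folklore] -/
theorem cxEnd_sub (τ₁ τ₂ : Module.End ℚ (ι → ℚ)) : cxEnd (τ₁ - τ₂) = cxEnd τ₁ - cxEnd τ₂ :=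
  map_sub cxEndHom τ₁ τ₂

/-- Complexification of a finite sum. [folklore] -/
theorem cxEnd_sum {κ : Type*} (s : Finset κ) (τ : κ → Module.End ℚ (ι → ℚ)) :
    cxEnd (∑ i ∈ s, τ i) = ∑ i ∈ s, cxEnd (τ i) :=
  map_sum cxEndHom τ s

/-- A complexification maps integral vectors to rational vectors. [folklore] -/
theorem cxEnd_intVec (τ : Module.End ℚ (ι → ℚ)) (v : ι → ℤ) :
    ∃ w : ι → ℚ, cxEnd τ (fun i => (v i : ℂ)) = fun i => (w i : ℂ) :=
  ⟨τ fun i => (v i : ℚ), by rw [intCastVec_eq_ratCastVec, cxEnd_ratVec]⟩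

/-- **A complexification is real**: it commutes with complex conjugation of the coordinates. [folklore] -/
theorem cxEnd_star (τ : Module.End ℚ (ι → ℚ)) (z : ι → ℂ) : cxEnd τ (star z) = star (cxEnd τ z) := by
  have hz : z = ∑ j, z j • (Pi.basisFun ℂ ι) j := by
    conv_lhs => rw [← (Pi.basisFun ℂ ι).sum_repr z]
    simp only [Pi.basisFun_repr]
  have hsz : star z = ∑ j, star (z j) • (Pi.basisFun ℂ ι) j := by
    conv_lhs => rw [hz]
    rw [star_sum]
    refine Finset.sum_congr rfl fun j _ => ?_
    rw [star_smul, basisFun_eq_ratCastVec, star_ratVec]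
  conv_rhs => rw [hz]
  rw [hsz, map_sum, map_sum, star_sum]
  refine Finset.sum_congr rfl fun j _ => ?_
  rw [map_smul, map_smul, star_smul, basisFun_eq_ratCastVec, cxEnd_ratVec, star_ratVec]

/-- **The complexification of a rational isometry is an isometry of the complex form**, for a complex
bilinear form `B_ℂ` restricting to `B` on rational vectors. [cite: Huybrechts2016K3, Ch. 3 §2.2] -/
theorem form_cxEnd {B : LinearMap.BilinForm ℚ (ι → ℚ)} {BC : LinearMap.BilinForm ℂ (ι → ℂ)}
    (hBC : ∀ v w : ι → ℚ, BC (fun i => (v i : ℂ)) (fun i => (w i : ℂ)) = ((B v w : ℚ) : ℂ))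
    (τ : Module.End ℚ (ι → ℚ)) (hτ : ∀ v w, B (τ v) (τ w) = B v w) (a b : ι → ℂ) :
    BC (cxEnd τ a) (cxEnd τ b) = BC a b := by
  have h : BC.compl₁₂ (cxEnd τ) (cxEnd τ) = BC := by
    refine bilin_eq_of_forall_ratVec fun v w => ?_
    rw [LinearMap.compl₁₂_apply, cxEnd_ratVec, cxEnd_ratVec, hBC, hBC, hτ]
  have h' := LinearMap.congr_fun₂ h a b
  rwa [LinearMap.compl₁₂_apply] at h'

/-- The image of a vector under a complexification lies in the complex span of the image of `τ`.
[folklore] -/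
theorem cxEnd_mem_span (τ : Module.End ℚ (ι → ℚ)) (z : ι → ℂ) :
    cxEnd τ z ∈ Submodule.span ℂ (Set.range fun v : ι → ℚ => fun i => (τ v i : ℂ)) := by
  have hz : z = ∑ j, z j • (Pi.basisFun ℂ ι) j := by
    conv_lhs => rw [← (Pi.basisFun ℂ ι).sum_repr z]
    simp only [Pi.basisFun_repr]
  rw [hz, map_sum]
  refine Submodule.sum_mem _ fun j _ => ?_
  rw [map_smul, basisFun_eq_ratCastVec, cxEnd_ratVec]
  exact Submodule.smul_mem _ _ (Submodule.subset_span ⟨_, rfl⟩)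

/-- A complexification with `τ(ℚ^ι) ⊆ N` takes values in the complex span of `N`. [folklore] -/
theorem cxEnd_mem_span_of_forall_mem (τ : Module.End ℚ (ι → ℚ)) (N : Submodule ℚ (ι → ℚ))
    (hτ : ∀ v, τ v ∈ N) (z : ι → ℂ) :
    cxEnd τ z ∈ Submodule.span ℂ (Set.range fun n : N => fun i => ((n : ι → ℚ) i : ℂ)) := by
  refine Submodule.span_mono ?_ (cxEnd_mem_span τ z)
  rintro _ ⟨v, rfl⟩
  exact ⟨⟨τ v, hτ v⟩, rfl⟩

/-! ### The complexification `ℂ ⊗_ℚ T` of a subspace `T ≤ ℚ^ι`, inside `ℂ^ι` -/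

section Subspace

variable (T : Submodule ℚ (ι → ℚ))

/-- **`ι_T : ℂ ⊗_ℚ T → ℂ^ι`**, `c ⊗ t ↦ c · ι(t)`: the abstract complexification of a rational subspace
realised inside `ℂ^ι` (generic-index version of `AnchorExistenceCMFloor.iota`). [cite: VoisinHodgeI2002, §7.1.1] -/
def iota : ℂ ⊗[ℚ] T →ₗ[ℂ] (ι → ℂ) :=
  (TensorProduct.piScalarRight ℚ ℂ ℂ ι).toLinearMap ∘ₗ (T.subtype.baseChange ℂ)

/-- `ι_T (c ⊗ t) = c · ι(t)`. [folklore] -/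
theorem iota_tmul (c : ℂ) (t : T) : iota T (c ⊗ₜ[ℚ] t) = c • fun i => ((t : ι → ℚ) i : ℂ) := by
  simp only [iota, LinearMap.comp_apply, LinearMap.baseChange_tmul, LinearEquiv.coe_coe,
    TensorProduct.piScalarRight_apply, TensorProduct.piScalarRightHom_tmul, Submodule.subtype_apply]
  funext i
  simp only [Pi.smul_apply, smul_eq_mul, Rat.smul_def, mul_comm]

/-- `ι_T (1 ⊗ t) = ι(t)`. [folklore] -/
theorem iota_one_tmul (t : T) : iota T (1 ⊗ₜ[ℚ] t) = fun i => ((t : ι → ℚ) i : ℂ) := by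
  rw [iota_tmul, one_smul]

/-- `ι_T` takes values in the complex span of `T`. [folklore] -/
theorem iota_mem_span (z : ℂ ⊗[ℚ] T) :
    iota T z ∈ Submodule.span ℂ (Set.range fun t : T => fun i => ((t : ι → ℚ) i : ℂ)) := by
  induction z using TensorProduct.induction_on with
  | zero => rw [map_zero]; exact Submodule.zero_mem _
  | tmul c t =>
    rw [iota_tmul]
    exact Submodule.smul_mem _ _ (Submodule.subset_span ⟨t, rfl⟩)
  | add a b ha hb => rw [map_add]; exact Submodule.add_mem _ ha hb

/-- **`ι_T` intertwines `conj ⊗ id` with complex conjugation of the coordinates.** [cite: VoisinHodgeI2002, §7.1.1] -/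
theorem iota_conj (z : ℂ ⊗[ℚ] T) : iota T (HodgeStructure.conj z) = star (iota T z) := by
  induction z using TensorProduct.induction_on with
  | zero => rw [map_zero, map_zero, star_zero]
  | tmul c t =>
    rw [HodgeStructure.conj_tmul, iota_tmul, iota_tmul, star_smul, star_ratVec]
    rfl
  | add a b ha hb => rw [map_add, map_add, map_add, star_add, ha, hb]

/-- **`ι_T` is injective** (`ℂ` is flat over `ℚ`). [cite: VoisinHodgeI2002, §7.1.1] -/
theorem iota_injective : Function.Injective (iota T) := by
  have h1 : Function.Injective (T.subtype.baseChange ℂ) := by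
    rw [LinearMap.baseChange_eq_ltensor]
    exact Module.Flat.lTensor_preserves_injective_linearMap _ T.injective_subtype
  intro a b h
  exact h1 ((TensorProduct.piScalarRight ℚ ℂ ℂ ι).injective h)

/-- **The base change of the restricted form is the complex form under `ι_T`**:
`(B|_T)_ℂ(z, z') = B_ℂ(ι_T z, ι_T z')`. [cite: Huybrechts2016K3, Ch. 3 §2.2] -/
theorem restrict_baseChange_apply {B : LinearMap.BilinForm ℚ (ι → ℚ)} {BC : LinearMap.BilinForm ℂ (ι → ℂ)}
    (hBC : ∀ v w : ι → ℚ, BC (fun i => (v i : ℂ)) (fun i => (w i : ℂ)) = ((B v w : ℚ) : ℂ))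
    (z z' : ℂ ⊗[ℚ] T) : (B.restrict T).baseChange ℂ z z' = BC (iota T z) (iota T z') := by
  induction z using TensorProduct.induction_on with
  | zero => rw [map_zero, LinearMap.zero_apply, map_zero, map_zero, LinearMap.zero_apply]
  | tmul c t =>
    induction z' using TensorProduct.induction_on with
    | zero => rw [map_zero, map_zero, map_zero]
    | tmul c' t' =>
      rw [LinearMap.BilinForm.baseChange_tmul, iota_tmul, iota_tmul, LinearMap.BilinForm.smul_left,
        LinearMap.BilinForm.smul_right, hBC, LinearMap.BilinForm.restrict_apply, LinearMap.domRestrict_apply,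
        Rat.smul_def]
      ring
    | add a b ha hb => rw [map_add, map_add, map_add, ha, hb]
  | add a b ha hb => rw [map_add, LinearMap.add_apply, map_add, map_add, LinearMap.add_apply, ha, hb]

variable {T} {N : Submodule ℚ (ι → ℚ)} (hc : IsCompl N T)

/-- **The retraction `λ_T : ℂ^ι → ℂ ⊗_ℚ T`** attached to a complement `N` of `T`: `λ_T(eⱼ) = 1 ⊗ pr_T(eⱼ)`
(generic-index version of `AnchorExistenceCMFloor.lam`). [cite: Huybrechts2016K3, Ch. 3 Lemma 3.3.1] -/
def lam (hc : IsCompl N T) : (ι → ℂ) →ₗ[ℂ] ℂ ⊗[ℚ] T :=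
  (Pi.basisFun ℂ ι).constr ℂ fun j => (1 : ℂ) ⊗ₜ[ℚ] (T.projectionOnto N hc.symm (Pi.single j 1))

/-- `λ_T (ι v) = 1 ⊗ pr_T(v)` for `v ∈ ℚ^ι`. [folklore] -/
theorem lam_ratVec (v : ι → ℚ) : lam hc (fun i => (v i : ℂ)) = (1 : ℂ) ⊗ₜ[ℚ] (T.projectionOnto N hc.symm v) := by
  rw [ratVec_eq_sum, map_sum]
  simp only [map_smul, lam, Module.Basis.constr_basis]
  conv_rhs => rw [eq_sum_single v, map_sum, TensorProduct.tmul_sum]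
  refine Finset.sum_congr rfl fun j _ => ?_
  rw [map_smul, TensorProduct.tmul_smul, ratCast_smul_eq]

/-- **`λ_T ∘ ι_T = id`.** [folklore] -/
theorem lam_iota (z : ℂ ⊗[ℚ] T) : lam hc (iota T z) = z := by
  induction z using TensorProduct.induction_on with
  | zero => rw [map_zero, map_zero]
  | tmul c t =>
    rw [iota_tmul, map_smul, lam_ratVec, Submodule.projectionOnto_apply_left, TensorProduct.smul_tmul', smul_eq_mul,
      mul_one]
  | add a b ha hb => rw [map_add, map_add, ha, hb]

/-- **`ι_T ∘ λ_T` is the complexified projection onto `T` along `N`.** [folklore] -/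
theorem iota_lam (z : ι → ℂ) : iota T (lam hc z) = cxEnd (T.projection N hc.symm) z := by
  have h : iota T ∘ₗ lam hc = cxEnd (T.projection N hc.symm) :=
    eq_cxEnd_of_forall fun v => by rw [LinearMap.comp_apply, lam_ratVec, iota_one_tmul]; rfl
  exact LinearMap.congr_fun h z

/-- Pointwise: `z = pr_{N,ℂ} z + pr_{T,ℂ} z`. [folklore] -/
theorem cxEnd_projection_add_apply (z : ι → ℂ) :
    cxEnd (N.projection T hc) z + cxEnd (T.projection N hc.symm) z = z := by
  have h : cxEnd (N.projection T hc) + cxEnd (T.projection N hc.symm) = LinearMap.id := by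
    rw [← cxEnd_add, Submodule.projection_add_projection_eq_id, cxEnd_id]
  have h' := LinearMap.congr_fun h z
  rwa [LinearMap.add_apply] at h'

/-- **A vector of the complex span of `T` is in the image of `ι_T`: `ι_T (λ_T z) = z`.** [folklore] -/
theorem iota_lam_of_mem_span {z : ι → ℂ}
    (hz : z ∈ Submodule.span ℂ (Set.range fun t : T => fun i => ((t : ι → ℚ) i : ℂ))) : iota T (lam hc z) = z := by
  induction hz using Submodule.span_induction with
  | mem w hw =>
    obtain ⟨t, rfl⟩ := hw
    rw [lam_ratVec, Submodule.projectionOnto_apply_left, iota_one_tmul]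
  | zero => rw [map_zero, map_zero]
  | add a b _ _ ha hb => rw [map_add, map_add, ha, hb]
  | smul c a _ ha => rw [map_smul, map_smul, ha]

/-- The image of `ι_T` is killed by the complexified projection onto `N`. [folklore] -/
theorem cxEnd_projection_iota (z : ℂ ⊗[ℚ] T) : cxEnd (N.projection T hc) (iota T z) = 0 := by
  have h := cxEnd_projection_add_apply hc (iota T z)
  rw [← iota_lam hc, lam_iota hc] at h
  have h' := congrArg (fun w => w - iota T z) h
  simpa only [add_sub_cancel_right, sub_self] using h'

/-- The complexified projection onto `N` takes values in the complex span of `N`. [folklore] -/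
theorem cxEnd_projection_mem_span (z : ι → ℂ) :
    cxEnd (N.projection T hc) z ∈ Submodule.span ℂ (Set.range fun n : N => fun i => ((n : ι → ℚ) i : ℂ)) :=
  cxEnd_mem_span_of_forall_mem _ N (fun v => Submodule.projection_apply_mem hc v) z

end Subspace

end Summit.HodgeConjecture.HodgeConjecture.Theorems.MarkmanPartnerTransport.LatticeBridge

end
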